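import Mathlib.Algebra.MvPolynomial.PDeriv
import Mathlib.Algebra.MvPolynomial.Monad
import Mathlib.Algebra.MvPolynomial.Funext
import Mathlib.LinearAlgebra.Matrix.Nondegenerate
import Mathlib.LinearAlgebra.Matrix.Rank
import Literature.Computability.AlgebraicComplexity.AlderStrassenProofs
import Literature.Computability.AlgebraicComplexity.Lickteig1985TypicalRank444
import Literature.LinearAlgebra.Matrix.IntRowCertificateUnitPivot
import HarnessLib

/-!
# Lickteig 1985, typical rank of `4 × 4 × 4`: proof file (discharge of `Lickteig1985_typicalRank444`)

Sibling proof file of `Literature/Computability/AlgebraicComplexity/Lickteig1985TypicalRank444.lean`,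
discharging its named fact
`Literature.Computability.AlgebraicComplexity.Lickteig1985_typicalRank444`: over every algebraically
closed field `K` of characteristic zero, EVERY tensor `t ∈ K⁴ ⊗ K⁴ ⊗ K⁴` has border rank
(`algBorderRank`, the `ε`-notion of BCS Def. (15.19) / Bläser Def. 6.1) at most `7` — the typical rank
of the format `(4,4,4)` is `⌈4³/(3·4-2)⌉ = 7` (Lickteig 1985; BCS Ex. 20.9, "in particular `R̲(4,4,4) = 7`").
HONEST FRAMING (pub-tensor bundle, unit b2b-tensor-1, gen 13): the value is a THEOREM deciding two
entries of a border-rank TABLE of explicit small tensors (rows `CY4-18`, `CY4-32`: `bR = 7` over every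
algebraically closed field of characteristic zero, now unconditional) — NOT progress on the exponent of
matrix multiplication; no laser-method barrier is touched.

## The proof (Terracini's lemma in coordinates + the Jacobian criterion + Alder's theorem)

1. `S_7(4,4,4)`, the set of tensors of rank `≤ 7`, is the image of the secant parametrisation
   `σ_7 : K^{84} → K^{64}`, `(w_ρ, u_ρ, v_ρ)_{ρ<7} ↦ ∑_ρ w_ρ ⊗ u_ρ ⊗ v_ρ` (BCS §20.1), given by `64`
   cubic polynomials `φ_{(i,j,l)} = ∑_ρ a_{ρ i} b_{ρ j} c_{ρ l}` in `84` variables (`secantParam`).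
2. **The differential of `σ_7` is surjective at one explicit integer point** `p ∈ {0,1}^{84}`: the
   `64 × 64` minor of the Jacobian `(∂φ_s/∂x_t)(p)` on `64` explicit pivot columns `e` has rank `64`
   over every field, certified by a sparse UNIT-PIVOT integer row certificate checked by
   `decide +kernel` (`intTriCheckUnit`, tree file `LinearAlgebra/Matrix/IntRowCertificateUnitPivot.lean`;
   the certificate — `64` integer row combinations with coefficients in `{0, ±1, ±2}` — was found by exact
   elimination outside Lean, only its verification is trusted to the kernel).  Hence the Jacobian
   determinant `det (∂φ_s/∂x_{e(s')})_{s,s'} ∈ K[x]` is a non-zero polynomial (its value at `p` is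
   non-zero).  This is Terracini's lemma made explicit: `dim σ_7(Seg(ℙ³×ℙ³×ℙ³)) = 63`, the expected
   dimension, i.e. the `7`-th secant variety fills the ambient space (Lickteig).
3. **Jacobian criterion** (characteristic `0`; Humphreys 1990 §3.10, Proposition, whose half-page proof
   we formalise verbatim: a minimal-degree annihilating polynomial `h`, the chain rule
   `∂_t h(f) = ∑_s (∂_s h)(f) · ∂_t f_s`, and the non-singular linear system): if some maximal Jacobian
   minor of `f_1, …, f_n ∈ K[x]` is a non-zero polynomial then the `f_s` are algebraically independent,
   i.e. the substitution `P ↦ P(f)` (`MvPolynomial.bind₁ f`) is injective (`bind₁_injective_of_det_ne_zero`).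
4. Hence a polynomial vanishing on `S_7` is `0` (it vanishes on the image of `σ_7`, so `P(φ) = 0` as a
   polynomial by `MvPolynomial.funext` over the infinite field `K`, so `P = 0`): the Zariski closure
   `X_7` of `S_7` is all of `K^{4×4×4}` — and by **Alder's theorem** (BCS Thm. (20.3), PROVED in the tree:
   `alder_secantVariety_eq_setOf_algBorderRank_le_holds`, `AlderStrassenProofs.lean`) `X_7 = {t | R̲(t) ≤ 7}`.

Consequences made unconditional here: `algBorderRank_CY4_18`, `algBorderRank_CY4_32` (`= 7`), from the
conditional `…_of_typicalRank` rows of the fact file and the kernel-checked tangency lower bounds.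

## References

* T. Lickteig, *Typical tensorial rank*, Linear Algebra Appl. 69 (1985) 95–120. [Lickteig1985]
* P. Bürgisser, M. Clausen, M. A. Shokrollahi, *Algebraic Complexity Theory* (1997): §20.1 (`σ_r`,
  `S_r(f)`, `X_r(f)`), Thm. (20.3) (Alder), Ex. 20.9 (`R̲(4,4,4) = 7`). [BurgisserClausenShokrollahi1997]
* J. E. Humphreys, *Reflection Groups and Coxeter Groups* (1990), §3.10 "Jacobian criterion for algebraic
  independence", Proposition and its proof. [Humphreys1990]
-/

open scoped BigOperators
open MvPolynomial

namespace Literature.Computability.AlgebraicComplexity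

open Literature.LinearAlgebra.Matrix

universe u

/-! ## §1. The Jacobian criterion (Humphreys 1990, §3.10) -/

section JacobianCriterion

variable {K : Type*} [CommRing K] {σ τ : Type*}

/-- **Chain rule** for the substitution `P ↦ P(f)`: `∂_t (P(f)) = ∑_s ∂_t f_s · (∂_s P)(f)`
(Humphreys 1990, §3.10, display (23)). [cite: Humphreys1990, §3.10 (23)] -/
theorem pderiv_bind₁ [Fintype σ] [DecidableEq σ] [DecidableEq τ] (f : σ → MvPolynomial τ K) (t : τ)
    (P : MvPolynomial σ K) :
    pderiv t (bind₁ f P) = ∑ s, pderiv t (f s) * bind₁ f (pderiv s P) := by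
  induction P using MvPolynomial.induction_on with
  | C a => simp
  | add p q hp hq => rw [map_add, map_add, hp, hq, ← Finset.sum_add_distrib]; simp only [map_add, mul_add]
  | mul_X p s₀ h =>
    have key : ∀ s, bind₁ f (pderiv s (X s₀ : MvPolynomial σ K)) = if s = s₀ then 1 else 0 := by
      intro s
      split_ifs with hs
      · subst hs; simp
      · rw [pderiv_X_of_ne (Ne.symm hs), map_zero]
    rw [map_mul, bind₁_X_right, pderiv_mul, h]
    simp_rw [pderiv_mul, map_add, map_mul, bind₁_X_right, key, mul_add, Finset.sum_add_distrib,
      mul_ite, mul_one, mul_zero, Finset.sum_ite_eq', Finset.mem_univ, if_true, Finset.sum_mul]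
    congr 1
    · exact Finset.sum_congr rfl fun s _ => by ring
    · ring

/-- A partial derivative lowers the total degree: `deg ∂_i P ≤ deg P - 1` ("each `∂h/∂y_i` has smaller
degree than `h`", Humphreys 1990, §3.10). [cite: Humphreys1990, §3.10 (proof of the Proposition)] -/
theorem totalDegree_pderiv_le_sub_one (i : σ) (P : MvPolynomial σ K) :
    (pderiv i P).totalDegree ≤ P.totalDegree - 1 := by
  classical
  apply Finset.sup_le
  intro m hm
  rw [mem_support_iff, coeff_pderiv] at hm
  have hc : coeff (m + Finsupp.single i 1) P ≠ 0 := fun h0 => hm (by rw [h0, zero_mul])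
  have hle := le_totalDegree (mem_support_iff.mpr hc)
  rw [Finsupp.sum_add_index' (fun _ => rfl) (fun _ _ _ => rfl), Finsupp.sum_single_index rfl] at hle
  omega

/-- In characteristic zero a polynomial all of whose partial derivatives vanish is a constant ("because
`h` is not constant, not all `∂h/∂y_i` can vanish", Humphreys 1990, §3.10).
[cite: Humphreys1990, §3.10 (proof of the Proposition)] -/
theorem eq_C_of_forall_pderiv_eq_zero [CharZero K] [IsDomain K] {P : MvPolynomial σ K}
    (h : ∀ i, pderiv i P = 0) : P = C (coeff 0 P) := by
  classical
  ext m
  rw [coeff_C]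
  split_ifs with hm
  · rw [← hm]
  · obtain ⟨i, hi⟩ : ∃ i, m i ≠ 0 := by
      by_contra hcon
      push Not at hcon
      exact (Ne.symm hm) (Finsupp.ext fun i => by simpa using hcon i)
    have hsingle : Finsupp.single i 1 ≤ m := by
      rw [Finsupp.single_le_iff]; omega
    have hc := coeff_pderiv (i := i) P (m - Finsupp.single i 1)
    rw [h i, coeff_zero, tsub_add_cancel_of_le hsingle] at hc
    have hne : (((m - Finsupp.single i 1 : σ →₀ ℕ) i : K) + 1) ≠ 0 := Nat.cast_add_one_ne_zero _
    exact (mul_eq_zero.mp hc.symm).resolve_right hne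

/-- **Jacobian criterion for algebraic independence** (characteristic `0`; Humphreys 1990, §3.10,
Proposition, direction "`J ≠ 0 ⇒` independent", in the rectangular form actually proved there): if for
polynomials `f_s ∈ K[x_τ]` (`s ∈ σ`) some square Jacobian minor `det (∂ f_s / ∂ x_{e(s')})_{s,s'}` is a
non-zero polynomial, then the `f_s` are algebraically independent over `K`, i.e. `P ↦ P(f)` is injective.
Proof as in loc. cit.: for an annihilating `P ≠ 0` of minimal degree, the chain rule gives the linear
system `∑_s (∂_s P)(f) ∂_t f_s = 0` with non-singular coefficient matrix, so all `(∂_s P)(f) = 0`, and the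
`∂_s P` have smaller degree. [cite: Humphreys1990, §3.10 Proposition] -/
theorem bind₁_injective_of_det_ne_zero {K : Type*} [Field K] [CharZero K] [Fintype σ] [DecidableEq σ]
    [DecidableEq τ] (f : σ → MvPolynomial τ K) (e : σ → τ)
    (hdet : (Matrix.of fun s s' : σ => pderiv (e s') (f s)).det ≠ 0) :
    Function.Injective (bind₁ f) := by
  rw [injective_iff_map_eq_zero]
  have hconst : ∀ P : MvPolynomial σ K, P = C (coeff 0 P) → bind₁ f P = 0 → P = 0 := by
    intro P hP h0
    rw [hP, bind₁_C_right, C_eq_zero] at h0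
    rw [hP, h0, C_0]
  suffices hmain : ∀ n : ℕ, ∀ P : MvPolynomial σ K, P.totalDegree ≤ n → bind₁ f P = 0 → P = 0 from
    fun P hP => hmain _ P le_rfl hP
  intro n
  induction n with
  | zero =>
    intro P hdeg h0
    exact hconst P (totalDegree_eq_zero_iff_eq_C.mp (Nat.le_zero.mp hdeg)) h0
  | succ n ih =>
    intro P hdeg h0
    have hv : Matrix.vecMul (fun s => bind₁ f (pderiv s P))
        (Matrix.of fun s s' : σ => pderiv (e s') (f s)) = 0 := by
      funext s'
      have hd := congrArg (pderiv (e s')) h0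
      rw [pderiv_bind₁, map_zero] at hd
      rw [Matrix.vecMul, Pi.zero_apply, ← hd]
      simp only [dotProduct, Matrix.of_apply]
      exact Finset.sum_congr rfl fun s _ => mul_comm _ _
    have hz := Matrix.eq_zero_of_vecMul_eq_zero hdet hv
    have hds : ∀ s, pderiv s P = 0 := fun s =>
      ih _ ((totalDegree_pderiv_le_sub_one s P).trans (by omega)) (congr_fun hz s)
    exact hconst P (eq_C_of_forall_pderiv_eq_zero hds) h0

/-- A square matrix over a field whose rank is the full dimension has non-zero determinant. [folklore] -/
private theorem det_ne_zero_of_rank_eq_card {ι : Type*} [Fintype ι] [DecidableEq ι] {F : Type*} [Field F]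
    (M : Matrix ι ι F) (h : M.rank = Fintype.card ι) : M.det ≠ 0 := by
  intro hdet
  obtain ⟨v, hv, hMv⟩ := Matrix.exists_mulVec_eq_zero_iff.mpr hdet
  have hker : v ∈ LinearMap.ker M.mulVecLin := by simpa using hMv
  have hk : 1 ≤ Module.finrank F (LinearMap.ker M.mulVecLin) := by
    rw [Nat.one_le_iff_ne_zero]
    intro h0
    have hbot : LinearMap.ker M.mulVecLin = ⊥ := Submodule.finrank_eq_zero.mp h0
    rw [hbot, Submodule.mem_bot] at hker
    exact hv hker
  have hsum := LinearMap.finrank_range_add_finrank_ker M.mulVecLin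
  rw [Module.finrank_fintype_fun_eq_card] at hsum
  have hr : M.rank = Module.finrank F (LinearMap.range M.mulVecLin) := rfl
  omega

end JacobianCriterion

/-! ## §2. The secant parametrisation `σ_r` over a general field -/

section Secant

variable (K : Type u) [CommSemiring K] (ι κ μ : Type) (r : ℕ)

/-- The parametrisation `σ_r` of `S_r` over `K` (the tree's `secantParametrisation` is the case `K = ℂ`):
source coordinates `(ρ, a) ↦ w_ρ(a)`, `(ρ, b) ↦ u_ρ(b)`, `(ρ, c) ↦ v_ρ(c)`, target coordinate
`(a, b, c) ↦ ∑_ρ w_ρ(a) u_ρ(b) v_ρ(c)`. [cite: BurgisserClausenShokrollahi1997, §20.1 (σ_r)] -/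
noncomputable def secantParam (x : ι × κ × μ) :
    MvPolynomial ((Fin r × ι) ⊕ ((Fin r × κ) ⊕ (Fin r × μ))) K :=
  ∑ ρ : Fin r, X (Sum.inl (ρ, x.1)) * X (Sum.inr (Sum.inl (ρ, x.2.1))) *
    X (Sum.inr (Sum.inr (ρ, x.2.2)))

variable {K ι κ μ r}

/-- Evaluating `σ_r` at a point gives the flattening of the corresponding sum of `r` triads.
[cite: BurgisserClausenShokrollahi1997, §20.1 (S_r(f) = im σ_r)] -/
theorem aeval_secantParam (y : (Fin r × ι) ⊕ ((Fin r × κ) ⊕ (Fin r × μ)) → K) (x : ι × κ × μ) :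
    aeval y (secantParam K ι κ μ r x) =
      uncurryTensor (∑ ρ : Fin r, triad (fun a => y (Sum.inl (ρ, a)))
        (fun b => y (Sum.inr (Sum.inl (ρ, b)))) (fun c => y (Sum.inr (Sum.inr (ρ, c))))) x := by
  obtain ⟨a, b, c⟩ := x
  simp only [secantParam, map_sum, map_mul, aeval_X, uncurryTensor_apply, Finset.sum_apply,
    triad_apply]

/-- **If `σ_r^*` is injective then `X_r` is everything**: a polynomial vanishing on `S_r` (the image of
`σ_r` over an infinite field) is the zero polynomial, so every tensor lies in the Zariski closure of
`S_r`. [cite: BurgisserClausenShokrollahi1997, §20.1; Thm. (20.3)] -/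
theorem mem_tensorZariskiClosure_of_bind₁_injective {K : Type u} [Field K] [Infinite K] [Fintype ι]
    [Fintype κ] [Fintype μ] [DecidableEq ι] [DecidableEq κ] [DecidableEq μ]
    (hinj : Function.Injective (bind₁ (secantParam K ι κ μ r))) (t : ι → κ → μ → K) :
    t ∈ tensorZariskiClosure {s : ι → κ → μ → K | tensorRank s ≤ r} := by
  rw [mem_tensorZariskiClosure_iff]
  intro P hP
  have hPφ : bind₁ (secantParam K ι κ μ r) P = 0 := by
    apply MvPolynomial.funext
    intro y
    have hy : (fun x => aeval y (secantParam K ι κ μ r x)) =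
        uncurryTensor (∑ ρ : Fin r, triad (fun a => y (Sum.inl (ρ, a)))
          (fun b => y (Sum.inr (Sum.inl (ρ, b)))) (fun c => y (Sum.inr (Sum.inr (ρ, c))))) :=
      funext fun x => aeval_secantParam y x
    rw [map_zero]
    change aeval y (bind₁ (secantParam K ι κ μ r) P) = 0
    rw [aeval_bind₁, hy]
    exact hP _ (tensorRank_le_of_eq_sum _ _ _ rfl)
  have hP0 : P = 0 := hinj (by rw [hPφ, map_zero])
  rw [hP0, map_zero]

end Secant

/-! ## §3. Format `4 × 4 × 4`, `r = 7`: the Jacobian of `σ_7` at an explicit point has rank `64` -/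

namespace Lickteig444

/-- Target index set `[4]³` (`64` coordinates). [folklore] -/
abbrev Idx : Type := Fin 4 × Fin 4 × Fin 4

/-- Source index set: `7 × (4 + 4 + 4) = 84` variables `a_{ρ i}, b_{ρ j}, c_{ρ l}`. [folklore] -/
abbrev Var : Type := (Fin 7 × Fin 4) ⊕ ((Fin 7 × Fin 4) ⊕ (Fin 7 × Fin 4))

/-- Code `a ↦ a mod 4 ∈ Fin 4`. [folklore] -/
def fin4 (a : ℕ) : Fin 4 := ⟨a % 4, Nat.mod_lt _ (by decide)⟩

/-- Code `a ↦ a mod 7 ∈ Fin 7`. [folklore] -/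
def fin7 (a : ℕ) : Fin 7 := ⟨a % 7, Nat.mod_lt _ (by decide)⟩

/-- The point `p`: table of the `a_{ρ i} ∈ {0,1}` (row `ρ`, entry `4ρ + i`). [folklore] -/
def paL : List ℤ := [1, 0, 1, 1, 1, 0, 1, 0, 1, 1, 1, 1, 0, 1, 0, 0, 1, 0, 0, 0, 1, 0, 0, 1, 1, 1, 1, 0]

/-- The point `p`: table of the `b_{ρ j} ∈ {0,1}`. [folklore] -/
def pbL : List ℤ := [1, 1, 0, 0, 1, 1, 0, 0, 0, 0, 1, 1, 1, 0, 1, 0, 0, 1, 0, 0, 0, 0, 1, 1, 1, 1, 1, 0]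

/-- The point `p`: table of the `c_{ρ l} ∈ {0,1}`. [folklore] -/
def pcL : List ℤ := [0, 1, 1, 0, 1, 1, 1, 1, 1, 0, 0, 1, 0, 0, 0, 1, 0, 1, 1, 1, 0, 0, 1, 1, 1, 1, 0, 0]

/-- Table lookup `(ρ, i) ↦ L[4ρ + i]` (missing entries read as `0`). [folklore] -/
def tab (L : List ℤ) (ρ : Fin 7) (i : Fin 4) : ℤ := L.getD (4 * ρ.val + i.val) 0

/-- The point `p ∈ K^{84}` (integer tables cast into `K`). [folklore] -/
def pt (K : Type u) [Ring K] : Var → K :=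
  Sum.elim (fun q => (tab paL q.1 q.2 : K))
    (Sum.elim (fun q => (tab pbL q.1 q.2 : K)) (fun q => (tab pcL q.1 q.2 : K)))

/-- Closed form of the Jacobian of `σ_7` at `p`: `∂φ_{(i,j,l)}/∂a_{ρ i'} = [i = i'] b_{ρ j} c_{ρ l}`,
`∂/∂b_{ρ j'} = [j = j'] a_{ρ i} c_{ρ l}`, `∂/∂c_{ρ l'} = [l = l'] a_{ρ i} b_{ρ j}` (integers). [folklore] -/
def jacInt (x : Idx) : Var → ℤ
  | Sum.inl q => if x.1 = q.2 then tab pbL q.1 x.2.1 * tab pcL q.1 x.2.2 else 0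
  | Sum.inr (Sum.inl q) => if x.2.1 = q.2 then tab paL q.1 x.1 * tab pcL q.1 x.2.2 else 0
  | Sum.inr (Sum.inr q) => if x.2.2 = q.2 then tab paL q.1 x.1 * tab pbL q.1 x.2.1 else 0

/-- Row code `r = 16 i + 4 j + l ↦ (i, j, l)`. [folklore] -/
def rowDec (r : ℕ) : Idx := (fin4 (r / 16), fin4 (r / 4), fin4 r)

/-- Row encoding `(i, j, l) ↦ 16 i + 4 j + l`. [folklore] -/
def rowEnc (x : Idx) : ℕ := 16 * x.1.val + 4 * x.2.1.val + x.2.2.val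

/-- Column code `q ↦` variable: `a_{ρ i'}` for `q = 4ρ + i' < 28`, `b_{ρ j'}` for `q = 28 + 4ρ + j'`,
`c_{ρ l'}` for `q = 56 + 4ρ + l'`. [folklore] -/
def colDec (q : ℕ) : Var :=
  if q < 28 then Sum.inl (fin7 (q / 4), fin4 q)
  else if q < 56 then Sum.inr (Sum.inl (fin7 ((q - 28) / 4), fin4 (q - 28)))
  else Sum.inr (Sum.inr (fin7 ((q - 56) / 4), fin4 (q - 56)))

/-- The `64` pivot columns (codes) of the certificate, in the order of the `64` target coordinates they
are assigned to. [folklore] -/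
def pivL : List ℕ :=
  [21, 55, 77, 17, 70, 11, 56, 22, 19, 5, 50, 69, 48, 78, 3, 65, 2, 14, 68, 54, 63, 51, 44, 74, 73,
    31, 37, 27, 47, 25, 23, 76, 18, 43, 42, 62, 53, 82, 66, 30, 10, 26, 39, 75, 49, 57, 6, 28, 33,
    72, 80, 7, 64, 35, 41, 40, 12, 60, 15, 46, 29, 24, 1, 83]

/-- The column selection `e : [4]³ → variables` of the square Jacobian minor (target coordinate with
code `c` ↦ pivot column `pivL[c]`). [folklore] -/
def e (x : Idx) : Var := colDec (pivL.getD (rowEnc x) 0)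

/-- The `64 × 64` integer matrix `N = (∂φ_s/∂x_{e(s')})(p)`. [folklore] -/
def Nint : Matrix Idx Idx ℤ := fun x y => jacInt x (e y)

/-- The `64` sparse integer row combinations `(row code, coefficient)` of the certificate (coefficients in
`{±1, ±2}`; found by exact elimination outside Lean). [folklore] -/
def certRows : List (List (ℕ × ℤ)) :=
  [[(30, 1)], [(29, 1)], [(61, 1)], [(22, 1)], [(18, 1)], [(60, 1)], [(48, 1)], [(46, 1)], [(55,
    1)], [(20, 1)], [(58, 1)], [(25, 1)], [(50, 1)], [(62, 1)], [(49, 1)], [(41, 1)], [(34, 1)],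
    [(35, 1)], [(24, 1)], [(40, 1)], [(39, 1)], [(15, 1)], [(1, 1)], [(6, 1)], [(5, 1)], [(29,
    -1), (45, 1)], [(48, -1), (52, 1)], [(56, 1), (60, -1)], [(14, 1), (62, -1)], [(21, 1), (22,
    -1)], [(10, 1), (58, -1)], [(8, 1), (40, -1)], [(34, -1), (38, 1)], [(30, -1), (31, 1)], [(27,
    1), (30, -1)], [(33, 1), (34, -1)], [(33, -1), (34, 1), (37, 1), (38, -1)], [(29, -1), (42,
    1), (45, 1), (46, -1)], [(29, -1), (45, 1), (46, -1), (47, 1)], [(29, -1), (40, -1), (41, 1),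
    (44, 1)], [(28, 1), (44, -1)], [(8, -1), (12, 1), (40, 1), (44, -1)], [(0, 1), (48, -1), (56,
    1), (60, -1)], [(7, 1), (34, -1), (38, 1), (39, -1)], [(48, -1), (49, -1), (52, 1), (53, 1),
    (55, -1)], [(0, 1), (48, -1), (49, 1), (50, -1), (51, 1)], [(0, -1), (8, 1), (12, -1), (32,
    1), (40, -1), (44, 1)], [(48, -1), (50, -1), (51, 1), (52, 1), (54, 1), (55, -1)], [(32, -1),
    (33, 1), (34, -1), (36, 1), (37, -1), (38, 1), (48, 1), (52, -1)], [(0, -1), (4, 1), (32, 1),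
    (36, -1)], [(40, 1), (41, -1), (44, -1), (45, 1), (56, -1), (57, 1), (60, 1), (61, -1)], [(1,
    -1), (2, 1), (8, 1), (12, -1), (33, 1), (34, -1), (40, -1), (44, 1), (51, -1)], [(10, 1), (13,
    1), (14, -1), (28, -1), (42, -1), (46, 1), (56, -1), (57, 1), (58, -1), (60, 1), (61, -2),
    (62, 1)], [(0, -1), (1, -1), (2, 1), (8, 1), (12, -1), (22, -1), (23, 1), (33, 1), (34, -1),
    (41, -1), (42, 1), (45, 1), (46, -1), (48, 2), (51, -1), (52, -1), (56, -1), (60, 1)], [(10,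
    -1), (11, 1), (14, 1), (15, -1), (22, 1), (23, -1), (48, -1), (52, 1), (56, -1), (57, 1), (60,
    1), (61, -1)], [(10, 1), (11, -1), (14, -1), (15, 1), (19, 1), (20, -1), (21, 1), (22, -1),
    (40, 1), (41, -1), (44, -1), (45, 1), (48, -1), (52, 1)], [(10, 1), (11, -1), (14, -1), (15,
    1), (34, 1), (35, -1), (38, -1), (39, 1), (42, -1), (43, 1), (46, 1), (47, -1), (50, -1), (51,
    1), (54, 1), (55, -1)], [(0, -1), (1, -1), (2, 1), (8, 1), (10, -1), (13, -1), (14, 2), (15,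
    -1), (33, 1), (34, -1), (41, -1), (42, 1), (45, 1), (46, -1), (48, 1), (51, -1), (56, -2),
    (57, 1), (59, 1), (60, 1), (62, -1)], [(56, 1), (57, -1), (58, 1), (59, -1), (60, -1), (61,
    1), (62, -1), (63, 1)], [(8, -1), (9, 1), (14, -1), (15, 1), (40, 1), (41, -1), (44, -1), (45,
    1), (60, 1), (61, -1), (62, 1), (63, -1)], [(0, -1), (1, -1), (3, 1), (9, 1), (11, -1), (13,
    -1), (15, 1), (32, 1), (35, -1), (41, -1), (43, 1), (45, 1), (47, -1), (48, 1), (49, 1), (51,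
    -1), (52, -1), (54, -1), (55, 1), (56, -1), (59, 1), (60, 1), (63, -1)], [(8, 1), (12, -1),
    (17, 1), (20, -1), (21, 1), (22, -1), (25, -1), (29, 1), (34, -2), (35, 2), (38, 2), (39, -2),
    (42, 1), (43, -2), (46, -1), (47, 2), (48, -1), (50, 2), (51, -2), (52, 1), (54, -2), (55, 2),
    (56, -1), (57, 1), (58, -2), (59, 2), (60, 1), (61, -1), (62, 2), (63, -2)], [(8, -1), (9, 1),
    (10, -1), (12, 1), (13, -1), (14, 1), (16, 1), (17, -1), (24, -1), (25, 1), (28, 1), (29, -1),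
    (40, 1), (41, -1), (42, 1), (44, -1), (45, 1), (46, -1), (56, 1), (57, -1), (58, 1), (60, -1),
    (61, 1), (62, -1)], [(8, 1), (9, -1), (10, 1), (12, -1), (13, 1), (14, -1), (16, -1), (17, 1),
    (18, -1), (20, 1), (21, -1), (22, 1), (24, 1), (25, -1), (26, 1), (28, -1), (29, 1), (30, -1),
    (34, 1), (35, -1), (38, -1), (39, 1), (40, -2), (41, 2), (42, -2), (43, 1), (44, 2), (45, -2),
    (46, 2), (47, -1), (48, 1), (50, -1), (51, 1), (52, -1), (54, 1), (55, -1), (59, -1), (63,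
    1)]]

/-- **The kernel check**: `(P · N)_{a, b}` (`a, b < 64`, pivots `b ↦ b`) is lower-triangular with
diagonal entries `±1` — `rank N = 64` over every field. [folklore] -/
private theorem intTriCheckUnit_certRows :
    intTriCheckUnit 64 (fun r c => Nint (rowDec r) (rowDec c)) certRows (List.range 64) = true := by
  decide +kernel

/-- `rank (N ⊗ F) = 64` over every field `F`. [folklore] -/
private theorem rank_Nint (F : Type*) [Field F] :
    (Nint.map (Int.cast : ℤ → F)).rank = Fintype.card Idx := by
  refine le_antisymm (Matrix.rank_le_card_width _) ?_
  have h := le_rank_of_intTriCheckUnit (F := F) Nint rowDec rowDec intTriCheckUnit_certRows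
  have hc : Fintype.card Idx = 64 := by simp [Fintype.card_prod]
  rw [hc]
  exact h

/-- `det (N ⊗ F) ≠ 0` over every field `F`. [folklore] -/
private theorem det_Nint_ne_zero (F : Type*) [Field F] : (Nint.map (Int.cast : ℤ → F)).det ≠ 0 :=
  det_ne_zero_of_rank_eq_card _ (rank_Nint F)

section Symbolic

variable (K : Type u) [Field K]

/-- `σ_7` for the format `4 × 4 × 4`. [cite: BurgisserClausenShokrollahi1997, §20.1 (σ_r)] -/
noncomputable abbrev φ : Idx → MvPolynomial Var K := secantParam K (Fin 4) (Fin 4) (Fin 4) 7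

/-- Value at `p` of the derivative of a coordinate: `(∂ x_u / ∂ x_t)(p) = [u = t]`. [folklore] -/
private theorem eval_pderiv_X (t u : Var) :
    eval (pt K) (pderiv t (X u : MvPolynomial Var K)) = if u = t then 1 else 0 := by
  rw [pderiv_X, Pi.single_apply]
  split_ifs <;> simp

/-- **The Jacobian of `σ_7` at `p` is the integer matrix `jacInt`** (entrywise, cast into `K`).
[folklore] -/
private theorem eval_pderiv_φ (x : Idx) (t : Var) :
    eval (pt K) (pderiv t (φ K x)) = (jacInt x t : K) := by
  obtain ⟨i, j, l⟩ := x
  simp only [φ, secantParam, map_sum, pderiv_mul, map_add, map_mul, eval_X, eval_pderiv_X]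
  rcases t with ⟨ρ, i'⟩ | ⟨ρ, j'⟩ | ⟨ρ, l'⟩
  · by_cases h : i = i'
    · subst h
      simp [jacInt, pt, Finset.sum_ite_eq']
    · simp [jacInt, pt, h]
  · by_cases h : j = j'
    · subst h
      simp [jacInt, pt, Finset.sum_ite_eq']
    · simp [jacInt, pt, h]
  · by_cases h : l = l'
    · subst h
      simp [jacInt, pt, Finset.sum_ite_eq']
    · simp [jacInt, pt, h]

/-- The symbolic square Jacobian minor `(∂φ_s/∂x_{e(s')})_{s,s'}` evaluates at `p` to `N ⊗ K`.
[folklore] -/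
private theorem jacobian_map_eval :
    (Matrix.of fun s s' : Idx => pderiv (e s') (φ K s)).map (eval (pt K)) =
      Nint.map (Int.cast : ℤ → K) := by
  ext s s'
  simp only [Matrix.map_apply, Matrix.of_apply, eval_pderiv_φ, Nint]

/-- **Terracini at `p`**: the Jacobian determinant of `σ_7` on the pivot columns is a non-zero
polynomial. [cite: Lickteig1985, p. 95] -/
theorem det_jacobian_ne_zero [CharZero K] :
    (Matrix.of fun s s' : Idx => pderiv (e s') (φ K s)).det ≠ 0 := by
  intro h0
  have h := RingHom.map_det (eval (pt K)) (Matrix.of fun s s' : Idx => pderiv (e s') (φ K s))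
  rw [h0, map_zero, RingHom.mapMatrix_apply, jacobian_map_eval] at h
  exact det_Nint_ne_zero K h.symm

/-- The `64` cubics `φ_{(i,j,l)}` are algebraically independent: `σ_7^*` is injective.
[cite: Lickteig1985, p. 95] -/
theorem bind₁_φ_injective [CharZero K] : Function.Injective (bind₁ (φ K)) :=
  bind₁_injective_of_det_ne_zero (φ K) e (det_jacobian_ne_zero K)

end Symbolic

end Lickteig444

/-! ## §4. The discharge and the two table rows -/

/-- **Lickteig 1985 — the typical rank of `4 × 4 × 4` is `7`, border-rank reading — PROVED**: over every
algebraically closed field of characteristic zero every `4 × 4 × 4` tensor has border rank `≤ 7`.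
Discharge of the named fact `Lickteig1985_typicalRank444` (Terracini's lemma at an explicit point with a
kernel-checked rank certificate, the Jacobian criterion, and Alder's theorem
`alder_secantVariety_eq_setOf_algBorderRank_le_holds`). [cite: Lickteig1985, p. 95]
[cite: BurgisserClausenShokrollahi1997, Ex. 20.9; Thm. (20.3)] -/
theorem Lickteig1985_typicalRank444_holds : Lickteig1985_typicalRank444 := by
  intro K _ _ _ t
  classical
  have hmem := mem_tensorZariskiClosure_of_bind₁_injective (Lickteig444.bind₁_φ_injective K) t
  rw [alder_secantVariety_eq_setOf_algBorderRank_le_holds 7] at hmem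
  exact hmem

namespace SmallTensorBorderRank

/-- `bR(CY4-18 ⊗ K) = 7` over every algebraically closed field of characteristic zero — UNCONDITIONAL
(upper bound: the typical rank `7`, `Lickteig1985_typicalRank444_holds`; lower bound: the kernel-checked
tangency certificate `seven_le_algBorderRank_CY4_18`). Bundle row `numerics/cert/brank/CY4-18.json`.
[cite: Lickteig1985, p. 95] [cite: DolezalekMichalek2026, Cor 3.9] -/
theorem algBorderRank_CY4_18 (K : Type) [Field K] [IsAlgClosed K] [CharZero K] :
    algBorderRank (fun i j l => ((ApproxCert.ofEntries 4 4 4 [((0, 1, 3), 1), ((0, 2, 1), 1), ((0, 3, 2), 1), ((1, 0, 2), 1), ((1, 1, 1), 1), ((1, 3, 0), 1), ((2, 0, 3), 1), ((2, 1, 0), 1), ((2, 2, 2), 1), ((3, 0, 1), 1), ((3, 2, 0), 1), ((3, 3, 3), 1)]) i j l : K)) = 7 :=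
  algBorderRank_CY4_18_of_typicalRank Lickteig1985_typicalRank444_holds K

/-- `bR(CY4-32 ⊗ K) = 7` over every algebraically closed field of characteristic zero — UNCONDITIONAL
(upper bound: `Lickteig1985_typicalRank444_holds`; lower bound: `seven_le_algBorderRank_CY4_32`).
Bundle row `numerics/cert/brank/CY4-32.json`. [cite: Lickteig1985, p. 95]
[cite: DolezalekMichalek2026, Cor 3.9] -/
theorem algBorderRank_CY4_32 (K : Type) [Field K] [IsAlgClosed K] [CharZero K] :
    algBorderRank (fun i j l => ((ApproxCert.ofEntries 4 4 4 [((0, 2, 3), 1), ((0, 3, 1), 1), ((1, 0, 3), 1), ((1, 1, 1), 1), ((1, 3, 2), 1), ((2, 1, 3), 1), ((2, 2, 2), 1), ((2, 3, 0), 1), ((3, 0, 2), 1), ((3, 1, 0), 1), ((3, 2, 1), 1)]) i j l : K)) = 7 :=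
  algBorderRank_CY4_32_of_typicalRank Lickteig1985_typicalRank444_holds K

end SmallTensorBorderRank

end Literature.Computability.AlgebraicComplexity
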